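import Summits.BirchSwinnertonDyer.Rank1Residual.P2.CongruentNumberSilentEvenFiveEnclosureMaximal
import Summits.BirchSwinnertonDyer.Rank1Residual.P2.CongruentNumberSilentEvenFiveEnclosureRungTwoAoki
import HarnessLib

/-!
# Cell «bsd-monsky» (prover-A): THE `k = 2` RUNG OF C-P2-2 FROM THE MAXIMAL SYSTEM FACT AND AOKI'S COUNT —
# `CongruentSilentEvenBSDTwoAt 2` from {`hAo`, `hSys⁗`}, `CongruentEvenBSDTwoAt 2` / `CongruentEvenOrdTwoAt 2` from
# {U⁺, GZK, `hAo`, `hSys⁗`} (nothing asserted)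

HONEST FRAMING: nothing asserted; conditional on `hSys⁗` (`Tian2014.tian2014_system_sMinus_maximal`: Tian Thm. 2.8 system ∧
TYZ Thm. 3.3 at `χ₀` ∧ TYZ p. 749 ∧ the seven one-sentence displays of `Tian2014/CMPointSystemBridgeMaximal.lean` ∧ Gauss genus
theory), `hAo` (Aoki 1999 Thm. 2.2), U⁺ and GZK. One-line compositions of `P2/…EnclosureRungTwoAoki.lean` through the kernel
implication `tian2014_system_sMinus_maximal ⟹ … ⟹ tian2014_system_sMinus_genus`; no Heath-Brown 1994 binder, no
Rédei–Reichardt binder, no Cor 5.15, no assembled sentence. The rungs `k ≥ 3` are NOT touched (README §3). Nothing booked.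
-/

noncomputable section

open scoped Classical

open WeierstrassCurve Literature.NumberTheory.EllipticCurves
  Literature.NumberTheory.EllipticCurves.Aoki1999
  Literature.NumberTheory.EllipticCurves.Rank1Residual
  Literature.NumberTheory.EllipticCurves.Rank1Residual.Typed
  Literature.NumberTheory.EllipticCurves.TianYuanZhang2017

set_option autoImplicit false

namespace Summit.BirchSwinnertonDyer.Rank1Residual.P2

open Conjectures Literature.NumberTheory.EllipticCurves.Tian2014

/-! ## §1 The `k = 2` rung of C-P2-2 from the maximal system fact and Aoki's count -/

/-- **THE SILENT `k = 2` RUNG from {`hAo`, `hSys⁗`}.** Conditional; nothing asserted.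
[cite: Aoki1999, Thm. 2.2 p. 81] [cite: Tian2014, Thm. 2.8 (J132), Def. 2.7, Prop. 2.1] [cite: Monsky1990MockHeegner, Remark (3) (p. 67)] -/
theorem congruentSilentEvenBSDTwoAt_two_of_maximalSystem_of_aoki (hAo : thm22_card_selmerGroup_two)
    (hSys : tian2014_system_sMinus_maximal) : CongruentSilentEvenBSDTwoAt 2 :=
  congruentSilentEvenBSDTwoAt_two_of_genusSystem_of_aoki hAo
    (tian2014_system_sMinus_genus_of_split
      (tian2014_system_sMinus_split_of_bridged (tian2014_system_sMinus_bridged_of_maximal hSys)))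

/-- **THE `k = 2` RUNG `CongruentEvenBSDTwoAt 2` from {U⁺, GZK, `hAo`, `hSys⁗`}** — no Heath-Brown 1994, no
Rédei–Reichardt, no Cor 5.15, no assembled sentence. Conditional; nothing asserted.
[cite: Aoki1999, Thm. 2.2 p. 81] [cite: TianYuanZhang2017, Thm. 1.2, Thm. 3.3, Thm. 3.5] [cite: Tian2014, Thm. 2.8 (J132), Def. 2.7, Prop. 2.1]
[cite: Monsky1990MockHeegner, Remark (3) (p. 67)] [cite: Miller2011LMS, Def. 1.1] -/
theorem congruentEvenBSDTwoAt_two_of_maximalSystem_of_aoki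
    (hU : ∀ (n : ℕ), Squarefree n → (n % 8 = 5 ∨ n % 8 = 6 ∨ n % 8 = 7) →
      ∃ L : ℤ, IsScriptL n L ∧
        ((n % 8 = 5 ∨ n % 8 = 7) → (2 : ℤ) ∣ L →
          Even (genusSum₁ n fun d => genusClassNumber (GenusField d)) ∧
          Even (genusSum₂' n fun d => genusClassNumber (GenusField d))) ∧
        (n % 8 = 6 → (2 : ℤ) ∣ L → Even (genusSum₂' n fun d => genusClassNumber (GenusField d))))
    (hGZK : rank_eq_analyticRank_of_analyticRank_le_one) (hAo : thm22_card_selmerGroup_two)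
    (hSys : tian2014_system_sMinus_maximal) : CongruentEvenBSDTwoAt 2 :=
  congruentEvenBSDTwoAt_two_of_genusSystem_of_aoki hU hGZK hAo
    (tian2014_system_sMinus_genus_of_split
      (tian2014_system_sMinus_split_of_bridged (tian2014_system_sMinus_bridged_of_maximal hSys)))

/-- **THE `k = 2` RUNG, SHARPER FORM `CongruentEvenOrdTwoAt 2` from {U⁺, GZK, `hAo`, `hSys⁗`}.** Conditional;
nothing asserted. [cite: Aoki1999, Thm. 2.2 p. 81] [cite: TianYuanZhang2017, §1 (1.1), Thm. 3.3] [cite: Tian2014, Def. 2.7, Prop. 2.1]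
[cite: Monsky1990MockHeegner, Remark (3) (p. 67)] -/
theorem congruentEvenOrdTwoAt_two_of_maximalSystem_of_aoki
    (hU : ∀ (n : ℕ), Squarefree n → (n % 8 = 5 ∨ n % 8 = 6 ∨ n % 8 = 7) →
      ∃ L : ℤ, IsScriptL n L ∧
        ((n % 8 = 5 ∨ n % 8 = 7) → (2 : ℤ) ∣ L →
          Even (genusSum₁ n fun d => genusClassNumber (GenusField d)) ∧
          Even (genusSum₂' n fun d => genusClassNumber (GenusField d))) ∧
        (n % 8 = 6 → (2 : ℤ) ∣ L → Even (genusSum₂' n fun d => genusClassNumber (GenusField d))))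
    (hGZK : rank_eq_analyticRank_of_analyticRank_le_one) (hAo : thm22_card_selmerGroup_two)
    (hSys : tian2014_system_sMinus_maximal) : CongruentEvenOrdTwoAt 2 :=
  congruentEvenOrdTwoAt_two_of_genusSystem_of_aoki hU hGZK hAo
    (tian2014_system_sMinus_genus_of_split
      (tian2014_system_sMinus_split_of_bridged (tian2014_system_sMinus_bridged_of_maximal hSys)))

end Summit.BirchSwinnertonDyer.Rank1Residual.P2

end
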